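import Summits.MatrixMultiplication.OmegaCensus.ThreeSetZ5Z5Cover44Defs
import HarnessLib

/-!
# Three-set `ℤ₅ × ℤ₅` cover, parts `4, 4` at `|A| = 625`: centroid frame `c = pt 5 24`, holes σ < 13

ω-census `pub-omega`, family (b3), seat pub-omega-group gen 36.  Framing: lottery ticket; floor = certified bounds/negative
ranges.  VALUE: finite kernel computations behind `ThreeSetZ5Z5Cells44.lean` (census cell `(4,4,13)@625`); NOT progress on ω.

`hi44_ci` (hole-independent frames `c = pt 5 ci`): `soundChk3 5 4 (tree44hi ci) (certHI ci) ∧ cover3C 5 4 (tree44hi ci)`;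
`c44_ci_lo/hi` (centroid frames `ci ∈ {12,19,23,24}`): for the holes `σ < 13` resp. `13 ≤ σ < 25`,
`soundChk3 5 4 (tree44 ci σ) (certLP ci σ) ∧ cover3C 5 4 (tree44 ci σ)` — all by `decide +kernel` (≈ 2–5 s per (frame, hole);
Python twin `pub-omega-group-g36/code/gen44.py`).  Assembled in `ThreeSetZ5Z5Cover44.lean`.
-/

namespace Summit.MatrixMultiplication.OmegaCensus

namespace Z5Z5ThreeSet

open ZpZpDomino

/-- Centroid frame `c = pt 5 24`, holes `σ < 13`: per-hole soundness checks and covers. [folklore] -/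
theorem c44_24_lo : ((List.range 13).all fun σ =>
    soundChk3 5 4 (tree44 24 σ) (certLP 24 σ) && cover3C 5 4 (tree44 24 σ)) = true := by
  decide +kernel

end Z5Z5ThreeSet

end Summit.MatrixMultiplication.OmegaCensus
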